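import Summits.Ventures.PercRepro.MSTightPartnerNonempty
import Summits.Ventures.PercRepro.MSTightConjTCandidate
import Summits.Ventures.PercRepro.MSTightConjTSecondDirection

/-!
# Conjecture (T) for twin-free families: every tightening direction

Dossier proofs/MINE1-theoremS.md, Addendum 56. The candidate Prop `ConjT α` (Addendum 45) asks
`diffsY r F ⊆ diffsX r F` at EVERY tightening direction `r` of an excess-one family `F` with
`∅, univ ∉ F`, empty core and full support — twins allowed, and `r` not assumed genuine
(`{r} ∈ F` and `univ.erase r ∈ F` allowed). This file settles every twin-free instance:

* `mem_of_subset_of_empty_mem` / `mem_of_superset_of_mem`: a tight twin-free family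
  containing `∅` (resp. `univ.erase r`, its members avoiding `r`) is a down-set (resp. an up-set
  of the sets avoiding `r`) — `mem_iff_parts` with the down-set `D(P)`;
* `diffsY_subset_diffsX_of_empty_mem_partr`: if `{r} ∈ F` (i.e. `∅ ∈ F₁`) then `Y ⊆ X` — every
  `z = t \ s ∈ Y` is a member of the down-set `P`, realised as `z \ ∅` with `∅ ∈ F₁`;
* `diffsY_subset_diffsX_of_erase_mem_part0`: if `univ.erase r ∈ F` then `Y ⊆ X` — the mirror,
  `z = (univ.erase r) \ ((univ.erase r) \ z)` with `univ.erase r ∈ F₀`;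
* the trace of a twin-free family with full support is twin-free (`twinFree_proj_of_twinFree`,
  MSTightConjTSecondDirection.lean);
* `diffsY_subset_diffsX_of_twinFree`: **Conjecture (T) at every tightening direction of a
  twin-free excess-one family with `∅, univ ∉ F`, empty core and full support** — the genuine
  directions by `diffsY_subset_diffsX_of_genuine` (Theorem (NE) + Addendum 54), the others by the
  two lemmas above. What separates this from `ConjT α` is exactly the twin reduction.
-/

namespace PercRepro.MSTight

open Finset
open scoped FinsetFamily

variable {α : Type*} [DecidableEq α] [Fintype α]

section DownUp

variable {P : Finset (Finset α)}

/-- A tight twin-free family containing `∅` is a down-set. -/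
theorem mem_of_subset_of_empty_mem (hP : Tight P) (htf : ∀ a b, Twin P a b → a = b)
    (h0 : (∅ : Finset α) ∈ P) {p q : Finset α} (hp : p ∈ P) (hqp : q ⊆ p) : q ∈ P := by
  have hD := isDownSet_diffs_of_twinFree hP htf
  have hρ : Rstar P ∈ P := Rstar_mem_of_dichotomy (dichotomy_of_tight hP) ⟨p, hp⟩
  rw [mem_iff_parts hP]
  constructor
  · exact hD _ (mem_diffs.2 ⟨p, hp, Rstar P, hρ, rfl⟩) _ (sdiff_subset_sdiff hqp (Subset.refl _))
  · refine hD _ (mem_diffs.2 ⟨Rstar P, hρ, ∅, h0, ?_⟩) _ sdiff_subset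
    exact sdiff_empty

/-- A tight twin-free family containing `M` is an up-set inside `M`. -/
theorem mem_of_superset_of_mem (hP : Tight P) (htf : ∀ a b, Twin P a b → a = b) {M : Finset α}
    (hM : M ∈ P) {p q : Finset α} (hp : p ∈ P) (hpq : p ⊆ q) (hqM : q ⊆ M) : q ∈ P := by
  have hD := isDownSet_diffs_of_twinFree hP htf
  have hρ : Rstar P ∈ P := Rstar_mem_of_dichotomy (dichotomy_of_tight hP) ⟨p, hp⟩
  rw [mem_iff_parts hP]
  constructor
  · exact hD _ (mem_diffs.2 ⟨M, hM, Rstar P, hρ, rfl⟩) _ (sdiff_subset_sdiff hqM (Subset.refl _))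
  · exact hD _ (mem_diffs.2 ⟨Rstar P, hρ, p, hp, rfl⟩) _ (sdiff_subset_sdiff (Subset.refl _) hpq)

end DownUp

section NonGenuine

variable {r : α} {F : Finset (Finset α)}

/-- **(T) when `{r} ∈ F`.** If `∅` is an `r`-member (i.e. `{r} ∈ F`) and the trace is tight and
twin-free, every type-I difference is an `r`-free difference. -/
theorem diffsY_subset_diffsX_of_empty_mem_partr (hP : Tight (proj r F))
    (htf : ∀ a b, Twin (proj r F) a b → a = b) (h0 : (∅ : Finset α) ∈ partr r F) :
    diffsY r F ⊆ diffsX r F := by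
  intro z hz
  obtain ⟨t, ht, s, hs, rfl⟩ := mem_diffs.1 hz
  have hzP : t \ s ∈ proj r F :=
    mem_of_subset_of_empty_mem hP htf (mem_proj_of_mem_partr h0) (mem_proj_of_mem_partr ht)
      sdiff_subset
  have h := sdiff_mem_diffsX_of_partr_right hzP h0
  rwa [sdiff_empty] at h

/-- **(T) when `univ.erase r ∈ F`.** If `univ.erase r` is an `r`-free member of a tight twin-free
trace, every type-I difference is an `r`-free difference. -/
theorem diffsY_subset_diffsX_of_erase_mem_part0 (hP : Tight (proj r F))
    (htf : ∀ a b, Twin (proj r F) a b → a = b) (hS : univ.erase r ∈ part0 r F) :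
    diffsY r F ⊆ diffsX r F := by
  intro z hz
  obtain ⟨t, ht, s, hs, rfl⟩ := mem_diffs.1 hz
  have hsP : s ∈ proj r F := mem_proj_of_mem_part0 hs
  have hSP : univ.erase r ∈ proj r F := mem_proj_of_mem_part0 hS
  have hsS : s ⊆ univ.erase r := fun x hx =>
    mem_erase.2 ⟨fun hxr => notMem_of_mem_proj hsP (hxr ▸ hx), mem_univ x⟩
  have hbP : univ.erase r \ (t \ s) ∈ proj r F :=
    mem_of_superset_of_mem hP htf hSP hsP
      (fun x hx => mem_sdiff.2 ⟨hsS hx, fun h => (mem_sdiff.1 h).2 hx⟩) sdiff_subset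
  have e : univ.erase r \ (univ.erase r \ (t \ s)) = t \ s := by
    apply Finset.sdiff_sdiff_eq_self
    intro x hx
    exact mem_erase.2 ⟨fun hxr => notMem_of_mem_proj (mem_proj_of_mem_partr ht)
      (hxr ▸ (mem_sdiff.1 hx).1), mem_univ x⟩
  have h := sdiff_mem_diffsX_of_part0_left hS hbP
  rwa [e] at h

end NonGenuine

section TwinFree

variable {r : α} {F : Finset (Finset α)}

/-- **Conjecture (T) for twin-free families, at every tightening direction.** For a twin-free
family `F` of Marica–Schönheim excess one with `∅, univ ∉ F`, empty core and full support, and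
any `r` whose trace `proj r F` is tight: `diffsY r F ⊆ diffsX r F`. -/
theorem diffsY_subset_diffsX_of_twinFree (htwF : ∀ a b, Twin F a b → a = b)
    (hF : (F \\ F).card = F.card + 1) (hE : (∅ : Finset α) ∉ F) (hU : (univ : Finset α) ∉ F)
    (hcore : ∀ a, ∃ t ∈ F, a ∉ t) (hsupp : ∀ a, ∃ t ∈ F, a ∈ t) (hP : Tight (proj r F)) :
    diffsY r F ⊆ diffsX r F := by
  have htf : ∀ a b, Twin (proj r F) a b → a = b := twinFree_proj_of_twinFree htwF hsupp
  by_cases hr : ({r} : Finset α) ∈ F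
  · exact diffsY_subset_diffsX_of_empty_mem_partr hP htf
      (mem_partr.2 ⟨notMem_empty r, by rw [insert_empty]; exact hr⟩)
  by_cases hS : univ.erase r ∈ F
  · exact diffsY_subset_diffsX_of_erase_mem_part0 hP htf (mem_part0.2 ⟨hS, notMem_erase r _⟩)
  apply diffsY_subset_diffsX_of_genuine hF hP htf
  · -- `∅ ∉ P`
    intro h
    obtain ⟨B, hB, hBr⟩ := mem_proj.1 h
    by_cases hrB : r ∈ B
    · have : B = {r} := by
        rw [← insert_erase hrB, hBr, insert_empty]
      exact hr (this ▸ hB)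
    · rw [erase_eq_of_notMem hrB] at hBr
      exact hE (hBr ▸ hB)
  · -- empty core
    intro a
    obtain ⟨t, ht, hat⟩ := hcore a
    exact ⟨t.erase r, mem_proj.2 ⟨t, ht, rfl⟩, fun h => hat (mem_of_mem_erase h)⟩
  · -- `univ.erase r ∉ P`
    intro h
    obtain ⟨B, hB, hBr⟩ := mem_proj.1 h
    by_cases hrB : r ∈ B
    · have : B = univ := by
        rw [← insert_erase hrB, hBr, insert_erase (mem_univ r)]
      exact hU (this ▸ hB)
    · rw [erase_eq_of_notMem hrB] at hBr
      exact hS (hBr ▸ hB)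
  · -- full support off `r`
    intro a har
    obtain ⟨t, ht, hat⟩ := hsupp a
    exact ⟨t.erase r, mem_proj.2 ⟨t, ht, rfl⟩, mem_erase.2 ⟨har, hat⟩⟩

/-- `X = D(P)` at every tightening direction of a twin-free family with `∅, univ ∉ F`, empty core
and full support. -/
theorem diffsX_eq_diffs_proj_of_twinFree (htwF : ∀ a b, Twin F a b → a = b)
    (hF : (F \\ F).card = F.card + 1) (hE : (∅ : Finset α) ∉ F) (hU : (univ : Finset α) ∉ F)
    (hcore : ∀ a, ∃ t ∈ F, a ∉ t) (hsupp : ∀ a, ∃ t ∈ F, a ∈ t) (hP : Tight (proj r F)) :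
    diffsX r F = proj r F \\ proj r F := by
  rw [diffs_proj_eq]
  exact (union_eq_left.2 (diffsY_subset_diffsX_of_twinFree htwF hF hE hU hcore hsupp hP)).symm

end TwinFree

end PercRepro.MSTight
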